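import Summits.QuantumFields.YangMills.Theorems.BalabanUVNodesN15KingModelBlockFieldNormalisationDensity
import Summits.QuantumFields.YangMills.Theorems.BalabanUVNodesN15KingModelRGDeterminantIdentity
import HarnessLib

/-!
# BalabanUVNodes ∕ N15 — THE KING-MODEL RUNG (PART Ε-w): THE FINE FLUCTUATION OPERATOR's FREE ENERGY PER FINE SITE IN INFINITE VOLUME —
# `|T_η|⁻¹ln det A₀ → f_∞(N², m²) + N^{−(d+1)}·(ln a − bzMean(ln Δ^{(K)}))` and `|T_η|⁻¹ln 𝒩(A₀) → ½ln 2π − ½·(that)` along any unit tori with all periods `→ ∞`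
# (Track A, DAG node N15 = NE2; FAN-OUT v1.1 §N15 s3 «KING-MODEL RUNG»; parts Ε-q (RG determinant identity) + Ε-m (free density) + Ε-t (block density); count-neutral)

HONEST FRAMING.  Count-neutral (cell `pub-ymgap`, seat `pub-ymgap-dag-n15-e` g40; `--supports stmt-QuantumFields-27366 --as helper` = K3⁸).
TEMPLATE LITERATURE: C. King, Commun. Math. Phys. **102** (1986) 649–677 [King1986], (2.4)–(2.6) p.652 (the fluctuation integral `∫ exp(−½⟨φ,A₀φ⟩ + …)dφ`, `A₀ = Δ^η + m² + aQ*Q`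
(2.13) p.653, its normalisation absorbed into `exp E₀`), (3.89) p.668, (3.93) p.669.  Part Ε-q proved `det A₀·det Δ^{(K)} = a^{|Ω|}·det B` on every unit torus (`c = N²`); part Ε-m
the thermodynamic limit `|T|⁻¹ln det B_T → kingFreeEnergyInf(c, m²)` of the free fine operator; part Ε-t `|Ω|⁻¹ln det Δ^{(K)} → bzMean(ln Δ^{(K)})`.  THIS FILE combines them: §1
`log_det_fineOp_eq` (`ln det A₀ = ln det B + |Ω|ln a − ln det Δ^{(K)}`), `card_tor_fine_real` (`|T_η| = N^{d+1}|Ω|`), `log_det_fineOp_div_card_eq` (per fine site: `|T|⁻¹ln det A₀ =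
|T|⁻¹ln det B + N^{−(d+1)}(ln a − |Ω|⁻¹ln det Δ^{(K)})`); §2 ★★ `tendsto_log_det_lapF_fine_div_card` (Ε-m along the fine tori `fine N (M_k)`), ★★★ **`tendsto_log_det_fineOp_div_card`**
(`|T_k|⁻¹ln det A₀ → kingFreeEnergyInf(N², m²) + N^{−(d+1)}·(ln a − bzMean(ln Δ^{(K)}))` — the free energy per fine site of King's fluctuation measure exists in infinite volume at
every RG step and splits into the free fine density plus the `N^{−(d+1)}`-weighted block correction), ★★★ **`tendsto_log_gaussNorm_fineOp_div_card`** (`|T_k|⁻¹ln 𝒩(A₀) → ½ln 2π −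
½·[…]`, part Ε-p's `gaussNorm_eq_det` for `A₀`).

PRIOR TREE ART (used, not restated): part Ε-q (`det_fineOp_mul_det_effLaplacian`, `det_fineOp_pos`), part Ε-m (`kingFreeEnergyInf`, `tendsto_log_det_lapF_div_card`), part Ε-t
(`tendsto_log_det_effLaplacian_div_card`), part Ε-p (`log_gaussNorm_eq`), part Ε-n (`det_effLaplacian_pos`), Ε-k (`det_lapF_pos`), `King1986` (`fineOp`, `fineOp_transpose`, `fineOp_coercive`),
`B5Block118.card_fine`, `B5Prop11Plancherel` (`fine`, `Tor`).  NOT Bałaban's covariant objects; NOT a node discharge (N15 is booked through n15-a's knit, untouched); nothing continuum-YM ∕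
`ℝ⁴` ∕ OS ∕ Clay.  0 `sorry`, 0 `def`.

HONEST SCOPE.  King's `A = 0` free model; unit tori `Π_νℤ∕M_ν` (dimension `d+1`), fine tori `Π_νℤ∕NM_ν`, `N ≥ 1`, `c = N²`, `a > 0`, `m² > 0`.  Locators: [King1986] (2.4)–(2.6) p.652, (2.13)
p.653, (3.89) p.668, (3.93) p.669.
-/

noncomputable section

open scoped BigOperators Topology
open Finset Filter

namespace Summit.QuantumFields.YangMills.BalabanUVNodes.N15KingModelRung.TorusSpectral

open Literature.MathematicalPhysics.QuantumFieldTheory.Balaban1983to89.B5Prop11Plancherel (Tor fine sOf)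
open Literature.MathematicalPhysics.QuantumFieldTheory.Balaban1983to89.B5Block118 (card_fine)
open Literature.MathematicalPhysics.QuantumFieldTheory.King1986 (DeltaEff)
open Literature.MathematicalPhysics.QuantumFieldTheory.King1986.Torus
open Summit.QuantumFields.YangMills.BalabanUVNodes.N15KingModelRung.FreeField (gaussNorm)

variable {d : ℕ} (N : ℕ) [NeZero N]

/-! ## §1 Finite volume: the logarithm of the RG determinant identity, per fine site -/

section Finite

variable (M : Fin (d + 1) → ℕ) [hM : ∀ μ, NeZero (M μ)]

/-- `ln det A₀ = ln det B + |Ω|·ln a − ln det Δ^{(K)}` (part Ε-q's identity, logarithms). [cite: King1986, (2.6) p.652, (2.13)–(2.16) p.653] -/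
theorem log_det_fineOp_eq (hN1 : 1 ≤ N) {a m2 : ℝ} (ha : 0 < a) (hm : 0 < m2) :
    Real.log (fineOp N M a ((N : ℝ) ^ 2) m2).det
      = Real.log (lapF (fine N M) ((N : ℝ) ^ 2) m2).det + Fintype.card (Tor M) * Real.log a - Real.log (effLaplacian N M a ((N : ℝ) ^ 2) m2).det := by
  have h := det_fineOp_mul_det_effLaplacian N M hN1 ha hm
  have hA := det_fineOp_pos N M hN1 ha hm
  have hΔ := det_effLaplacian_pos N M ha (by positivity : (0 : ℝ) ≤ (N : ℝ) ^ 2) hm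
  have hB := det_lapF_pos (fine N M) (by positivity : (0 : ℝ) ≤ (N : ℝ) ^ 2) hm
  have hlog := congrArg Real.log h
  rw [Real.log_mul hA.ne' hΔ.ne', Real.log_mul (pow_pos ha _).ne' hB.ne', Real.log_pow] at hlog
  linarith

/-- `|T_η| = N^{d+1}·|Ω|` (real form). [folklore] -/
theorem card_tor_fine_real : (Fintype.card (Tor (fine N M)) : ℝ) = (N : ℝ) ^ (d + 1) * Fintype.card (Tor M) := card_fine N M

/-- per fine site: `|T|⁻¹ln det A₀ = |T|⁻¹ln det B + N^{−(d+1)}·(ln a − |Ω|⁻¹ln det Δ^{(K)})`. [cite: King1986, (2.6) p.652, (3.89) p.668] -/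
theorem log_det_fineOp_div_card_eq (hN1 : 1 ≤ N) {a m2 : ℝ} (ha : 0 < a) (hm : 0 < m2) :
    (Fintype.card (Tor (fine N M)) : ℝ)⁻¹ * Real.log (fineOp N M a ((N : ℝ) ^ 2) m2).det
      = (Fintype.card (Tor (fine N M)) : ℝ)⁻¹ * Real.log (lapF (fine N M) ((N : ℝ) ^ 2) m2).det
        + ((N : ℝ) ^ (d + 1))⁻¹ * (Real.log a - (Fintype.card (Tor M) : ℝ)⁻¹ * Real.log (effLaplacian N M a ((N : ℝ) ^ 2) m2).det) := by
  have hΩ : (Fintype.card (Tor M) : ℝ) ≠ 0 := by exact_mod_cast Fintype.card_ne_zero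
  have hNd : ((N : ℝ) ^ (d + 1)) ≠ 0 := pow_ne_zero _ (by exact_mod_cast NeZero.ne N)
  rw [log_det_fineOp_eq N M hN1 ha hm, card_tor_fine_real N M]
  field_simp
  ring

end Finite

/-! ## §2 Infinite volume -/

section Limit

/-- ★★ part Ε-m along the FINE tori `Π_νℤ∕NM_{k,ν}`: `|T_k|⁻¹ln det(N²(−Δ)+m²)_{T_k} → kingFreeEnergyInf(N², m²)`. [cite: King1986, (3.89) p.668, (4.4) p.670] -/
theorem tendsto_log_det_lapF_fine_div_card {m2 : ℝ} (hm : 0 < m2) (Mseq : ℕ → Fin (d + 1) → ℕ) (hpos : ∀ k ν, 0 < Mseq k ν)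
    (hlim : ∀ ν, Tendsto (fun k => (Mseq k ν : ℝ)) atTop atTop) :
    Tendsto (fun k => haveI : ∀ ν, NeZero (Mseq k ν) := fun ν => ⟨(hpos k ν).ne'⟩
      (Fintype.card (Tor (fine N (Mseq k))) : ℝ)⁻¹ * Real.log (lapF (fine N (Mseq k)) ((N : ℝ) ^ 2) m2).det) atTop
      (𝓝 (kingFreeEnergyInf ((N : ℝ) ^ 2) m2 d)) := by
  have hN : 0 < N := Nat.pos_of_ne_zero (NeZero.ne N)
  have hpos' : ∀ k ν, 0 < fine N (Mseq k) ν := fun k ν => Nat.mul_pos hN (hpos k ν)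
  have hlim' : ∀ ν, Tendsto (fun k => (fine N (Mseq k) ν : ℝ)) atTop atTop := fun ν => by
    have h := (hlim ν).const_mul_atTop (by exact_mod_cast hN : (0 : ℝ) < N)
    refine h.congr fun k => ?_
    simp [fine]
  exact tendsto_log_det_lapF_div_card (by positivity) hm (fun k => fine N (Mseq k)) hpos' hlim'

/-- ★★★ **THE FLUCTUATION FREE ENERGY PER FINE SITE IN INFINITE VOLUME**: along any unit tori with all periods `→ ∞`,
`|T_k|⁻¹ln det A₀ → kingFreeEnergyInf(N², m²) + N^{−(d+1)}·(ln a − bzMean(ln Δ^{(K)}))` (`N ≥ 1`, `c = N²`, `a > 0`, `m² > 0`). [cite: King1986, (2.4)–(2.6) p.652, (2.13) p.653, (3.89) p.668] -/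
theorem tendsto_log_det_fineOp_div_card (hN1 : 1 ≤ N) {a m2 : ℝ} (ha : 0 < a) (hm : 0 < m2) (Mseq : ℕ → Fin (d + 1) → ℕ) (hpos : ∀ k ν, 0 < Mseq k ν)
    (hlim : ∀ ν, Tendsto (fun k => (Mseq k ν : ℝ)) atTop atTop) :
    Tendsto (fun k => haveI : ∀ ν, NeZero (Mseq k ν) := fun ν => ⟨(hpos k ν).ne'⟩
      (Fintype.card (Tor (fine N (Mseq k))) : ℝ)⁻¹ * Real.log (fineOp N (Mseq k) a ((N : ℝ) ^ 2) m2).det) atTop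
      (𝓝 (kingFreeEnergyInf ((N : ℝ) ^ 2) m2 d + ((N : ℝ) ^ (d + 1))⁻¹ * (Real.log a - bzMean (fun p : Fin (d + 1) → ℝ => Real.log (DeltaEff a N m2 p)) d))) := by
  have t1 := tendsto_log_det_lapF_fine_div_card N hm Mseq hpos hlim
  have t2 := tendsto_log_det_effLaplacian_div_card N hN1 ha hm Mseq hpos hlim
  refine (t1.add ((tendsto_const_nhds.sub t2).const_mul (((N : ℝ) ^ (d + 1))⁻¹))).congr fun k => ?_
  haveI : ∀ ν, NeZero (Mseq k ν) := fun ν => ⟨(hpos k ν).ne'⟩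
  exact (log_det_fineOp_div_card_eq N (Mseq k) hN1 ha hm).symm

/-- ★★★ **THE FLUCTUATION NORMALISATION PER FINE SITE IN INFINITE VOLUME**: `|T_k|⁻¹ln 𝒩(A₀) → ½ln 2π − ½·[kingFreeEnergyInf(N², m²) + N^{−(d+1)}(ln a − bzMean(ln Δ^{(K)}))]`.
[cite: King1986, (2.4)–(2.6) p.652, (3.89) p.668] -/
theorem tendsto_log_gaussNorm_fineOp_div_card (hN1 : 1 ≤ N) {a m2 : ℝ} (ha : 0 < a) (hm : 0 < m2) (Mseq : ℕ → Fin (d + 1) → ℕ) (hpos : ∀ k ν, 0 < Mseq k ν)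
    (hlim : ∀ ν, Tendsto (fun k => (Mseq k ν : ℝ)) atTop atTop) :
    Tendsto (fun k => haveI : ∀ ν, NeZero (Mseq k ν) := fun ν => ⟨(hpos k ν).ne'⟩
      (Fintype.card (Tor (fine N (Mseq k))) : ℝ)⁻¹ * Real.log (gaussNorm (fineOp N (Mseq k) a ((N : ℝ) ^ 2) m2))) atTop
      (𝓝 (1 / 2 * Real.log (2 * Real.pi)
        - 1 / 2 * (kingFreeEnergyInf ((N : ℝ) ^ 2) m2 d + ((N : ℝ) ^ (d + 1))⁻¹ * (Real.log a - bzMean (fun p : Fin (d + 1) → ℝ => Real.log (DeltaEff a N m2 p)) d)))) := by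
  have h := tendsto_log_det_fineOp_div_card N hN1 ha hm Mseq hpos hlim
  refine ((tendsto_const_nhds (x := 1 / 2 * Real.log (2 * Real.pi))).sub (h.const_mul (1 / 2))).congr fun k => ?_
  haveI : ∀ ν, NeZero (Mseq k ν) := fun ν => ⟨(hpos k ν).ne'⟩
  have hcard : (Fintype.card (Tor (fine N (Mseq k))) : ℝ) ≠ 0 := by exact_mod_cast Fintype.card_ne_zero
  have hc : (0 : ℝ) ≤ (N : ℝ) ^ 2 := by positivity
  rw [log_gaussNorm_eq (fineOp_transpose N (Mseq k) a _ m2) hm (fineOp_coercive N (Mseq k) m2 ha.le hc), mul_sub]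
  congr 1
  · field_simp
  · ring

end Limit

end Summit.QuantumFields.YangMills.BalabanUVNodes.N15KingModelRung.TorusSpectral

end
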